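import Summits.ValiantsHypothesis.ValiantsHypothesis.Theorems.LacunarySymmetroidMatrixDescartesCensusTwentyRootStructure
import Summits.ValiantsHypothesis.ValiantsHypothesis.Theorems.LacunarySymmetroidMatrixDescartesCensusPairBudgetKit
import Summits.ValiantsHypothesis.ValiantsHypothesis.Theorems.LacunarySymmetroidMatrixDescartesCensusSignVariationsFewnomial
import Summits.ValiantsHypothesis.ValiantsHypothesis.Theorems.LacunarySymmetroidMatrixDescartesStubVLawTwo

/-!
# `MatrixDescartes` census — the WEIGHTED-TRACE BUDGET of a hypothetical twenty: type flips are paid for by ONE Gram row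

HONEST FRAMING.  Object-search cell `pub-symmetroid`, door-A item `Theses.LacunarySymmetroid.DoorA26 = PosRootLawAt 2 6 19`
(stmt-ValiantsHypothesis-19979; OPEN, typed, never asserted).  A located NECESSARY CONDITION on a hypothetical twenty (a real
symmetric `2 × 2` six-term pencil `F(x) = ∑ x^{d_l} S_l` with `20` sorted distinct positive det-roots `r_0 < ⋯ < r_19`), valid for EVERY
support, refining the envelope layer of this seat's lineage (`card_traceFlips_le_three_of_twenty`, `pair_budget_of_twenty`): it ties the
ROOT-SIDE type word to COEFFICIENT-SIDE sign data (one row of the Gram matrix), which is what the chamber census reads.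

At a root `r_k` the matrix `F(r_k)` is non-zero, singular, semidefinite, with TYPE `sign tr F(r_k)` (`…CensusTwentyRootStructure`).
For every positive-definite weight `A = [[a, b], [b, c]]` (`a > 0`, `ac − b² > 0`) the weighted trace `tr(A·M) = a M₀₀ + 2b M₀₁ + c M₁₁`
of a non-zero singular symmetric `M` has the sign of `tr M` (`trace_mul_weightedTrace_pos`; identity
`a · tr M · tr(AM) = (aM₀₀ + bM₀₁)² + (aM₀₁ + bM₁₁)² + (ac − b²)(M₀₁² + M₁₁²) + a(a+c)·det M`).
Hence every TYPE FLIP `tr F(r_k) · tr F(r_{k+1}) < 0` is a sign change of the six-nomial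
`W_A(x) = tr(A·F(x)) = ∑_l x^{d_l} · (a (S_l)₀₀ + 2b (S_l)₀₁ + c (S_l)₁₁)` across the gap `(r_k, r_{k+1})`, and different flips use
different gaps:

* `card_traceFlips_le_card_posRoots_weightedTrace` — `#flips ≤ #{distinct positive roots of W_A}` for EVERY positive-definite weight;
* `card_traceFlips_le_signVariations_weightedTrace` — hence `#flips ≤ Var(W_A)` (Mathlib's Descartes bound);
* `card_traceFlips_le_card_posRoots_gramRow` — the weight `A = ± adj(S_p)` of a DEFINITE letter (`det S_p > 0`): the six-nomial is the
  GRAM ROW of that letter, `B_p(x) = ∑_l x^{d_l} · (S_p₁₁ S_l₀₀ − 2 S_p₀₁ S_l₀₁ + S_p₀₀ S_l₁₁)` (`= ∑_l x^{d_l} · 2B(S_p,S_l)` with `B` the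
  polarised determinant — row `p` of the cell's Minkowski Gram matrix, doubled), so `#flips ≤ #Z₊(B_p) ≤ Var(B_p)`;
* `card_traceFlips_le_alternations_gramRow` — on a SORTED support with non-vanishing Gram row: `#flips ≤ #{t < 5 : g_t g_{t+1} < 0}`, the
  number of adjacent sign alternations of the Gram row `(g_0, …, g_5)` of the definite letter — a number the sign class of a chamber fixes;
  `card_traceFlips_le_two_of_gramRow_signs` — the instance for the row pattern `(+,−,+,+,+,+)`: AT MOST TWO flips.

READING FOR THE HARD CHAMBERS OF THE CENSUS LINE (`Cruxes/DoorA26/Lines/census.lean`, chambers `[1, 954, 1706, 1709]`, whose sign classes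
have DEFINITE END LETTERS): in the class `DIIIID` of chamber 1706 (support type `(0,2,3,8,19,33)`) the Gram row of the bottom letter has the
sign pattern `(+,−,+,+,+,+)` along the sorted exponents, so a twenty there has AT MOST TWO type flips — an even number, the two end letters
having the same type: type word `P¹¹` or a single inner `N`-block; in the class `DIIIDD` of chamber 1709 (tall flag `(0,2,3,9,100,400)`) the
bottom row `(+,−,+,+,+,−)` gives at most `3` flips (an odd number).  Trivial bound from `tr F`: `5`; the envelope budget: `3` on every support.
What is NOT here: magnitudes; nothing bounds `ζ_sym(2,6)`; `DoorA26` / `DoorA34` stay OPEN; nothing on the crux `MatrixDescartes`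
(stmt-ValiantsHypothesis-18050) or on `VP ≠ VNP`.

[folklore] Elementary: `2 × 2` linear algebra (a singular symmetric matrix is `μ·nnᵀ` and `tr(A·nnᵀ) = nᵀAn > 0` for `A ≻ 0`), the
intermediate value theorem via the lineage's counting lemma `card_add_two_mul_card_le_card_posRoots`, and Descartes' rule of signs
(Mathlib `Polynomial.roots_countP_pos_le_signVariations`, the tree's `signVariations_rsum` and `StubVLawTwo.card_filter_pos_le_countP`); no single source.
-/

-- `Summit.ValiantsHypothesis.ValiantsHypothesis.…` repeats a component by the D-0017 layout
-- (single-conjunct summit), which the `dupNamespace` linter flags; the name is mandated.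
set_option linter.dupNamespace false

namespace Summit.ValiantsHypothesis.ValiantsHypothesis.Theorems.LacunarySymmetroidMatrixDescartes.Census

open Polynomial Finset
open scoped BigOperators Polynomial Matrix
open Summit.ValiantsHypothesis.ValiantsHypothesis.Theorems.SymmetroidDescartes (eval_det_pencil)

/-! ### The sign lemma: a positive-definite weighted trace reads the type of a singular symmetric matrix -/

/-- **A positive-definite weighted trace has the sign of the trace on the rank-one stratum.**  For a real symmetric `2 × 2` matrix
`M ≠ 0` with `det M = 0` and a positive-definite weight (`a > 0`, `a c − b² > 0`): `0 < tr M · (a M₀₀ + 2 b M₀₁ + c M₁₁)`.  (With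
`M = μ·nnᵀ`: `tr M = μ|n|²`, weighted trace `= μ·nᵀAn`.) [folklore] -/
theorem trace_mul_weightedTrace_pos (M : Matrix (Fin 2) (Fin 2) ℝ) (hM : M.IsSymm) (hdet : M.det = 0) (hM0 : M ≠ 0)
    {a b c : ℝ} (ha : 0 < a) (hac : 0 < a * c - b ^ 2) :
    0 < (M 0 0 + M 1 1) * (a * M 0 0 + 2 * b * M 0 1 + c * M 1 1) := by
  have hs : M 1 0 = M 0 1 := hM.apply 0 1
  rw [Matrix.det_fin_two, hs] at hdet
  have hne : ¬ (M 0 0 = 0 ∧ M 0 1 = 0 ∧ M 1 1 = 0) := by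
    rintro ⟨h00, h01, h11⟩
    apply hM0
    ext i j
    fin_cases i <;> fin_cases j
    · simpa using h00
    · simpa using h01
    · simpa [hs] using h01
    · simpa using h11
  have key : a * ((M 0 0 + M 1 1) * (a * M 0 0 + 2 * b * M 0 1 + c * M 1 1)) =
      (a * M 0 0 + b * M 0 1) ^ 2 + (a * M 0 1 + b * M 1 1) ^ 2 + (a * c - b ^ 2) * (M 0 1 ^ 2 + M 1 1 ^ 2)
        + a * (a + c) * (M 0 0 * M 1 1 - M 0 1 * M 0 1) := by ring
  rw [hdet, mul_zero, add_zero] at key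
  have hpos : 0 < (a * M 0 0 + b * M 0 1) ^ 2 + (a * M 0 1 + b * M 1 1) ^ 2
      + (a * c - b ^ 2) * (M 0 1 ^ 2 + M 1 1 ^ 2) := by
    by_contra hS
    rw [not_lt] at hS
    have hsq : M 0 1 ^ 2 + M 1 1 ^ 2 ≤ 0 := by
      by_contra h'
      rw [not_le] at h'
      have := mul_pos hac h'
      nlinarith [sq_nonneg (a * M 0 0 + b * M 0 1), sq_nonneg (a * M 0 1 + b * M 1 1)]
    have h01 : M 0 1 = 0 := by
      have h2 : M 0 1 ^ 2 = 0 := le_antisymm (by nlinarith [sq_nonneg (M 1 1)]) (sq_nonneg _)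
      exact (pow_eq_zero_iff two_ne_zero).1 h2
    have h11 : M 1 1 = 0 := by
      have h2 : M 1 1 ^ 2 = 0 := le_antisymm (by nlinarith [sq_nonneg (M 0 1)]) (sq_nonneg _)
      exact (pow_eq_zero_iff two_ne_zero).1 h2
    have hP : (a * M 0 0) ^ 2 ≤ 0 := by
      have h3 := hS
      rw [h01, h11] at h3
      ring_nf at h3
      nlinarith [h3, sq_nonneg (a * M 0 0)]
    have hP0 : a * M 0 0 = 0 :=
      (pow_eq_zero_iff two_ne_zero).1 (le_antisymm hP (sq_nonneg _))
    have h00 : M 0 0 = 0 := by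
      rcases mul_eq_zero.1 hP0 with h | h
      · exact absurd h ha.ne'
      · exact h
    exact hne ⟨h00, h01, h11⟩
  have hprod : 0 < a * ((M 0 0 + M 1 1) * (a * M 0 0 + 2 * b * M 0 1 + c * M 1 1)) := by
    rw [key]; exact hpos
  rcases lt_or_ge 0 ((M 0 0 + M 1 1) * (a * M 0 0 + 2 * b * M 0 1 + c * M 1 1)) with hX | hX
  · exact hX
  · exfalso
    nlinarith [mul_nonneg ha.le (neg_nonneg.mpr hX)]

/-! ### The weighted trace of the pencil is a six-nomial -/

/-- Entries of the evaluated pencil: `(∑ x^(d l) • S l) i j = ∑ x^(d l) · (S l) i j`. [folklore] -/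
theorem sum_smul_apply_eq {K : ℕ} (d : Fin K → ℕ) (S : Fin K → Matrix (Fin 2) (Fin 2) ℝ) (x : ℝ) (i j : Fin 2) :
    (∑ l, x ^ d l • S l) i j = ∑ l, x ^ d l * S l i j := by
  simp [Matrix.sum_apply, Matrix.smul_apply, smul_eq_mul]

/-- The weighted trace of the evaluated pencil is the `K`-nomial with coefficients the weighted traces of the letters:
`a F(x)₀₀ + 2b F(x)₀₁ + c F(x)₁₁ = ∑ x^(d l) · (a (S l)₀₀ + 2b (S l)₀₁ + c (S l)₁₁)`. [folklore] -/
theorem weightedTrace_sum_smul {K : ℕ} (d : Fin K → ℕ) (S : Fin K → Matrix (Fin 2) (Fin 2) ℝ) (a b c x : ℝ) :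
    a * (∑ l, x ^ d l • S l) 0 0 + 2 * b * (∑ l, x ^ d l • S l) 0 1 + c * (∑ l, x ^ d l • S l) 1 1
      = ∑ l, x ^ d l * (a * S l 0 0 + 2 * b * S l 0 1 + c * S l 1 1) := by
  rw [sum_smul_apply_eq, sum_smul_apply_eq, sum_smul_apply_eq, Finset.mul_sum, Finset.mul_sum, Finset.mul_sum,
    ← Finset.sum_add_distrib, ← Finset.sum_add_distrib]
  exact Finset.sum_congr rfl fun l _ => by ring

/-- Evaluation of the coefficient six-nomial `∑ X^(d l) · C (w l)` at `x` is `∑ x^(d l) · w l`. [folklore] -/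
theorem eval_sum_X_pow_mul_C {K : ℕ} (d : Fin K → ℕ) (w : Fin K → ℝ) (x : ℝ) :
    (∑ l, (X : ℝ[X]) ^ d l * C (w l)).eval x = ∑ l, x ^ d l * w l := by
  simp only [eval_finsetSum, eval_mul, eval_pow, eval_X, eval_C]

/-- Twenty sorted distinct positive members of `roots` give `20 ≤ #{distinct positive roots}`. [folklore] -/
theorem twenty_le_card_posRoots_of_sorted (p : ℝ[X]) (r : Fin 20 → ℝ) (hr : StrictMono r) (hr0 : ∀ k, 0 < r k)
    (hroot : ∀ k, r k ∈ p.roots) : 20 ≤ (p.roots.toFinset.filter (fun t => 0 < t)).card := by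
  classical
  have h1 : (Finset.univ.image r).card = 20 := by
    rw [Finset.card_image_of_injective _ hr.injective]; simp
  rw [← h1]
  apply Finset.card_le_card
  intro x hx
  obtain ⟨k, -, rfl⟩ := Finset.mem_image.mp hx
  rw [Finset.mem_filter, Multiset.mem_toFinset]
  exact ⟨hroot k, hr0 k⟩

/-! ### The weighted-trace budget -/

/-- **WEIGHTED-TRACE BUDGET** (symmetric letters, ANY support, ANY positive-definite weight).  Let a real symmetric `2 × 2`
six-term pencil have `20` sorted distinct positive det-roots `r 0 < ⋯ < r 19` (members of `roots`).  For every weight `a, b, c` with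
`a > 0`, `a c − b² > 0`, the number of TYPE FLIPS `tr F(r k) · tr F(r (k+1)) < 0` along consecutive roots is at most the number of
distinct positive roots of the weighted-trace six-nomial `∑ X^(d l) · C (a (S l)₀₀ + 2b (S l)₀₁ + c (S l)₁₁)`: at each root the weighted
trace has the sign of the trace (`trace_mul_weightedTrace_pos`), so each flip is a sign change of the six-nomial across its own gap
(counting lemma `card_add_two_mul_card_le_card_posRoots`). [folklore] -/
theorem card_traceFlips_le_card_posRoots_weightedTrace (d : Fin 6 → ℕ) (S : Fin 6 → Matrix (Fin 2) (Fin 2) ℝ)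
    (hS : ∀ l, (S l).IsSymm) (r : Fin 20 → ℝ) (hr : StrictMono r) (hr0 : ∀ k, 0 < r k)
    (hroot : ∀ k, r k ∈ (Matrix.det (∑ l, ((X : ℝ[X]) ^ d l) • (S l).map C)).roots)
    {a b c : ℝ} (ha : 0 < a) (hac : 0 < a * c - b ^ 2) :
    (Finset.univ.filter (fun k : Fin 19 =>
        ((∑ l, r k.castSucc ^ d l • S l) 0 0 + (∑ l, r k.castSucc ^ d l • S l) 1 1) *
          ((∑ l, r k.succ ^ d l • S l) 0 0 + (∑ l, r k.succ ^ d l • S l) 1 1) < 0)).card ≤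
      ((∑ l, (X : ℝ[X]) ^ d l * C (a * S l 0 0 + 2 * b * S l 0 1 + c * S l 1 1)).roots.toFinset.filter
        (fun t => 0 < t)).card := by
  classical
  set p := Matrix.det (∑ l, ((X : ℝ[X]) ^ d l) • (S l).map C) with hp
  have h20 : 20 ≤ (p.roots.toFinset.filter (fun t => 0 < t)).card :=
    twenty_le_card_posRoots_of_sorted p r hr hr0 hroot
  -- at every root, the weighted trace has the sign of the trace
  have hsgn : ∀ k : Fin 20,
      0 < ((∑ l, r k ^ d l • S l) 0 0 + (∑ l, r k ^ d l • S l) 1 1) *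
        (a * (∑ l, r k ^ d l • S l) 0 0 + 2 * b * (∑ l, r k ^ d l • S l) 0 1 + c * (∑ l, r k ^ d l • S l) 1 1) := by
    intro k
    have hisroot : p.IsRoot (r k) := (mem_roots'.mp (hroot k)).2
    obtain ⟨-, hne, hdet0, -, -⟩ := root_structure_of_twenty d S hS h20 (hr0 k) hisroot
    have hsym : (∑ l, r k ^ d l • S l).IsSymm := by
      unfold Matrix.IsSymm
      rw [Matrix.transpose_sum]
      exact Finset.sum_congr rfl fun l _ => by rw [Matrix.transpose_smul, (hS l).eq]
    exact trace_mul_weightedTrace_pos _ hsym hdet0 hne ha hac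
  -- the weighted-trace six-nomial
  set φ : ℝ[X] := ∑ l, (X : ℝ[X]) ^ d l * C (a * S l 0 0 + 2 * b * S l 0 1 + c * S l 1 1) with hφdef
  have hφ : ∀ x : ℝ, φ.eval x =
      a * (∑ l, x ^ d l • S l) 0 0 + 2 * b * (∑ l, x ^ d l • S l) 0 1 + c * (∑ l, x ^ d l • S l) 1 1 := by
    intro x
    rw [hφdef, eval_sum_X_pow_mul_C, weightedTrace_sum_smul]
  -- the flip set
  set Fl := Finset.univ.filter (fun k : Fin 19 =>
        ((∑ l, r k.castSucc ^ d l • S l) 0 0 + (∑ l, r k.castSucc ^ d l • S l) 1 1) *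
          ((∑ l, r k.succ ^ d l • S l) 0 0 + (∑ l, r k.succ ^ d l • S l) 1 1) < 0) with hFl
  have hA : ∀ k ∈ Fl, φ.eval (r k.castSucc) * φ.eval (r k.succ) < 0 := by
    intro k hk
    rw [hFl, Finset.mem_filter] at hk
    have hflip := hk.2
    have h1 := hsgn k.castSucc
    have h2 := hsgn k.succ
    rw [hφ, hφ]
    nlinarith [mul_pos h1 h2, hflip]
  have hcount := card_add_two_mul_card_le_card_posRoots φ r hr hr0 (fun _ => 0) Fl ∅ (Finset.disjoint_empty_right _)
    hA (by simp) (by simp) (by simp)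
  simpa using hcount

/-- **Descartes form of the weighted-trace budget**: `#flips ≤ Var(∑ X^(d l) · C (a (S l)₀₀ + 2b (S l)₀₁ + c (S l)₁₁))` for every
positive-definite weight (Mathlib's `Polynomial.roots_countP_pos_le_signVariations`). [folklore] -/
theorem card_traceFlips_le_signVariations_weightedTrace (d : Fin 6 → ℕ) (S : Fin 6 → Matrix (Fin 2) (Fin 2) ℝ)
    (hS : ∀ l, (S l).IsSymm) (r : Fin 20 → ℝ) (hr : StrictMono r) (hr0 : ∀ k, 0 < r k)
    (hroot : ∀ k, r k ∈ (Matrix.det (∑ l, ((X : ℝ[X]) ^ d l) • (S l).map C)).roots)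
    {a b c : ℝ} (ha : 0 < a) (hac : 0 < a * c - b ^ 2) :
    (Finset.univ.filter (fun k : Fin 19 =>
        ((∑ l, r k.castSucc ^ d l • S l) 0 0 + (∑ l, r k.castSucc ^ d l • S l) 1 1) *
          ((∑ l, r k.succ ^ d l • S l) 0 0 + (∑ l, r k.succ ^ d l • S l) 1 1) < 0)).card ≤
      (∑ l, (X : ℝ[X]) ^ d l * C (a * S l 0 0 + 2 * b * S l 0 1 + c * S l 1 1)).signVariations :=
  (card_traceFlips_le_card_posRoots_weightedTrace d S hS r hr hr0 hroot ha hac).trans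
    ((StubVLawTwo.card_filter_pos_le_countP _).trans (Polynomial.roots_countP_pos_le_signVariations _))

/-! ### The Gram row of a definite letter -/

/-- The Gram-row six-nomial with negated weights is the negative of the Gram-row six-nomial. [folklore] -/
theorem sum_X_pow_mul_C_neg {K : ℕ} (d : Fin K → ℕ) (w : Fin K → ℝ) :
    (∑ l, (X : ℝ[X]) ^ d l * C (-w l)) = -(∑ l, (X : ℝ[X]) ^ d l * C (w l)) := by
  rw [← Finset.sum_neg_distrib]
  exact Finset.sum_congr rfl fun l _ => by rw [C_neg, mul_neg]

/-- **GRAM-ROW BUDGET** (symmetric letters, ANY support).  If the letter `S p` is DEFINITE (`det (S p) > 0`), then along the `20` sorted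
distinct positive det-roots of a hypothetical twenty the number of type flips is at most the number of distinct positive roots of the
GRAM-ROW six-nomial `B_p = ∑ X^(d l) · C (S p₁₁ S l₀₀ − 2 S p₀₁ S l₀₁ + S p₀₀ S l₁₁)` — the weight `adj(S p)` (or its negative) in the
weighted-trace budget; the coefficient of `X^(d l)` is twice the polarised determinant `B(S p, S l)`, i.e. the Gram entry of the pair
`(p, l)` in the cell's Minkowski dictionary (and `2 det S p` at `l = p`). [folklore] -/
theorem card_traceFlips_le_card_posRoots_gramRow (d : Fin 6 → ℕ) (S : Fin 6 → Matrix (Fin 2) (Fin 2) ℝ)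
    (hS : ∀ l, (S l).IsSymm) (r : Fin 20 → ℝ) (hr : StrictMono r) (hr0 : ∀ k, 0 < r k)
    (hroot : ∀ k, r k ∈ (Matrix.det (∑ l, ((X : ℝ[X]) ^ d l) • (S l).map C)).roots)
    (p : Fin 6) (hp : 0 < (S p).det) :
    (Finset.univ.filter (fun k : Fin 19 =>
        ((∑ l, r k.castSucc ^ d l • S l) 0 0 + (∑ l, r k.castSucc ^ d l • S l) 1 1) *
          ((∑ l, r k.succ ^ d l • S l) 0 0 + (∑ l, r k.succ ^ d l • S l) 1 1) < 0)).card ≤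
      ((∑ l, (X : ℝ[X]) ^ d l * C (S p 1 1 * S l 0 0 - 2 * S p 0 1 * S l 0 1 + S p 0 0 * S l 1 1)).roots.toFinset.filter
        (fun t => 0 < t)).card := by
  classical
  have hs : S p 1 0 = S p 0 1 := (hS p).apply 0 1
  rw [Matrix.det_fin_two, hs] at hp
  have h00 : S p 0 0 ≠ 0 := by
    intro h0; rw [h0, zero_mul] at hp; nlinarith [sq_nonneg (S p 0 1)]
  rcases lt_or_gt_of_ne h00 with hneg | hpos
  · -- negative definite letter: weight `−adj(S p)`
    have h11 : S p 1 1 < 0 := by nlinarith [sq_nonneg (S p 0 1)]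
    have ha : 0 < -S p 1 1 := by linarith
    have hac : 0 < (-S p 1 1) * (-S p 0 0) - (S p 0 1) ^ 2 := by nlinarith
    have h := card_traceFlips_le_card_posRoots_weightedTrace d S hS r hr hr0 hroot ha hac
    have hpoly : (∑ l, (X : ℝ[X]) ^ d l * C (-S p 1 1 * S l 0 0 + 2 * S p 0 1 * S l 0 1 + -S p 0 0 * S l 1 1))
        = -(∑ l, (X : ℝ[X]) ^ d l * C (S p 1 1 * S l 0 0 - 2 * S p 0 1 * S l 0 1 + S p 0 0 * S l 1 1)) := by
      rw [← sum_X_pow_mul_C_neg]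
      exact Finset.sum_congr rfl fun l _ => by congr 1; congr 1; ring
    rw [hpoly, roots_neg] at h
    exact h
  · -- positive definite letter: weight `adj(S p)`
    have h11 : 0 < S p 1 1 := by nlinarith [sq_nonneg (S p 0 1)]
    have hac : 0 < S p 1 1 * S p 0 0 - (-S p 0 1) ^ 2 := by nlinarith
    have h := card_traceFlips_le_card_posRoots_weightedTrace d S hS r hr hr0 hroot h11 hac
    have hpoly : (∑ l, (X : ℝ[X]) ^ d l * C (S p 1 1 * S l 0 0 + 2 * (-S p 0 1) * S l 0 1 + S p 0 0 * S l 1 1))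
        = (∑ l, (X : ℝ[X]) ^ d l * C (S p 1 1 * S l 0 0 - 2 * S p 0 1 * S l 0 1 + S p 0 0 * S l 1 1)) :=
      Finset.sum_congr rfl fun l _ => by congr 1; congr 1; ring
    rw [hpoly] at h
    exact h

/-- **Gram-row budget, Descartes form**: `#flips ≤ Var(B_p)` for every definite letter `S p`. [folklore] -/
theorem card_traceFlips_le_signVariations_gramRow (d : Fin 6 → ℕ) (S : Fin 6 → Matrix (Fin 2) (Fin 2) ℝ)
    (hS : ∀ l, (S l).IsSymm) (r : Fin 20 → ℝ) (hr : StrictMono r) (hr0 : ∀ k, 0 < r k)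
    (hroot : ∀ k, r k ∈ (Matrix.det (∑ l, ((X : ℝ[X]) ^ d l) • (S l).map C)).roots)
    (p : Fin 6) (hp : 0 < (S p).det) :
    (Finset.univ.filter (fun k : Fin 19 =>
        ((∑ l, r k.castSucc ^ d l • S l) 0 0 + (∑ l, r k.castSucc ^ d l • S l) 1 1) *
          ((∑ l, r k.succ ^ d l • S l) 0 0 + (∑ l, r k.succ ^ d l • S l) 1 1) < 0)).card ≤
      (∑ l, (X : ℝ[X]) ^ d l * C (S p 1 1 * S l 0 0 - 2 * S p 0 1 * S l 0 1 + S p 0 0 * S l 1 1)).signVariations :=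
  (card_traceFlips_le_card_posRoots_gramRow d S hS r hr hr0 hroot p hp).trans
    ((StubVLawTwo.card_filter_pos_le_countP _).trans (Polynomial.roots_countP_pos_le_signVariations _))

/-! ### Sorted supports: the budget is the number of adjacent alternations of the Gram row -/

/-- On a SORTED support with all coefficients non-zero, the sign variations of `∑_{l<6} X^(d l) · C (g l)` are the adjacent
alternations `#{t < 5 : g t · g (t+1) < 0}` (the tree's `signVariations_rsum`, re-indexed over `Fin 6`). [folklore] -/
theorem signVariations_sum_fin_six_eq (d : Fin 6 → ℕ) (hd : StrictMono d) (g : Fin 6 → ℝ) (hg : ∀ l, g l ≠ 0) :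
    (∑ l, (X : ℝ[X]) ^ d l * C (g l)).signVariations =
      (Finset.univ.filter (fun t : Fin 5 => g t.castSucc * g t.succ < 0)).card := by
  classical
  -- extend the data to `ℕ`
  let e : ℕ → ℕ := fun t => if h : t < 6 then d ⟨t, h⟩ else d (Fin.last 5) + t
  let c : ℕ → ℝ := fun t => if h : t < 6 then g ⟨t, h⟩ else 0
  have he_lt : ∀ (t : ℕ) (h : t < 6), e t = d ⟨t, h⟩ := fun t h => by simp [e, h]
  have hc_lt : ∀ (t : ℕ) (h : t < 6), c t = g ⟨t, h⟩ := fun t h => by simp [c, h]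
  have he : StrictMono e := by
    intro s t hst
    by_cases ht : t < 6
    · have hs6 : s < 6 := lt_trans hst ht
      rw [he_lt s hs6, he_lt t ht]
      exact hd (Fin.mk_lt_mk.mpr hst)
    · rw [not_lt] at ht
      have het : e t = d (Fin.last 5) + t := by simp [e, not_lt.mpr ht]
      rw [het]
      by_cases hs6 : s < 6
      · rw [he_lt s hs6]
        have : d ⟨s, hs6⟩ ≤ d (Fin.last 5) := hd.monotone (Fin.le_last _)
        omega
      · rw [not_lt] at hs6
        have hes : e s = d (Fin.last 5) + s := by simp [e, not_lt.mpr hs6]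
        rw [hes]; omega
  have hc : ∀ t, t < 6 → c t ≠ 0 := fun t ht => by rw [hc_lt t ht]; exact hg _
  have hsum : (∑ l, (X : ℝ[X]) ^ d l * C (g l)) = ∑ t ∈ range 6, C (c t) * X ^ (e t) := by
    rw [← Fin.sum_univ_eq_sum_range (fun t => C (c t) * X ^ (e t)) 6]
    refine Finset.sum_congr rfl fun l _ => ?_
    rw [hc_lt l l.2, he_lt l l.2, mul_comm]
  rw [hsum, signVariations_rsum 6 (by norm_num) e he c hc]
  -- re-index the alternation count over `Fin 5`
  rw [show (6 - 1 : ℕ) = 5 from rfl, Finset.card_filter, ← Fin.sum_univ_eq_sum_range (fun t => if c t * c (t + 1) < 0 then 1 else 0) 5]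
  refine Finset.sum_congr rfl fun t _ => ?_
  have ht : (t : ℕ) < 6 := by omega
  have ht1 : (t : ℕ) + 1 < 6 := by omega
  have e1 : c t = g t.castSucc := by rw [hc_lt t ht]; rfl
  have e2 : c (t + 1) = g t.succ := by
    rw [hc_lt (t + 1) ht1]; congr 1
  simp only [e1, e2]

/-- **GRAM-ROW ALTERNATION BUDGET on a sorted support.**  Exponents sorted (`StrictMono d`), `S p` definite (`det (S p) > 0`), all six Gram-row
entries `g l = S p₁₁ S l₀₀ − 2 S p₀₁ S l₀₁ + S p₀₀ S l₁₁` non-zero (automatic for a twenty on a 2-Sidon support, where all `21` coefficients of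
`det` are non-zero — not re-proved here): the number of type flips along the roots of a hypothetical twenty is at most the number of
adjacent sign alternations `#{t < 5 : g t · g (t+1) < 0}` of the Gram row. [folklore] -/
theorem card_traceFlips_le_alternations_gramRow (d : Fin 6 → ℕ) (hd : StrictMono d) (S : Fin 6 → Matrix (Fin 2) (Fin 2) ℝ)
    (hS : ∀ l, (S l).IsSymm) (r : Fin 20 → ℝ) (hr : StrictMono r) (hr0 : ∀ k, 0 < r k)
    (hroot : ∀ k, r k ∈ (Matrix.det (∑ l, ((X : ℝ[X]) ^ d l) • (S l).map C)).roots)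
    (p : Fin 6) (hp : 0 < (S p).det)
    (hg : ∀ l, S p 1 1 * S l 0 0 - 2 * S p 0 1 * S l 0 1 + S p 0 0 * S l 1 1 ≠ 0) :
    (Finset.univ.filter (fun k : Fin 19 =>
        ((∑ l, r k.castSucc ^ d l • S l) 0 0 + (∑ l, r k.castSucc ^ d l • S l) 1 1) *
          ((∑ l, r k.succ ^ d l • S l) 0 0 + (∑ l, r k.succ ^ d l • S l) 1 1) < 0)).card ≤
      (Finset.univ.filter (fun t : Fin 5 =>
        (S p 1 1 * S t.castSucc 0 0 - 2 * S p 0 1 * S t.castSucc 0 1 + S p 0 0 * S t.castSucc 1 1) *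
          (S p 1 1 * S t.succ 0 0 - 2 * S p 0 1 * S t.succ 0 1 + S p 0 0 * S t.succ 1 1) < 0)).card := by
  have h := card_traceFlips_le_signVariations_gramRow d S hS r hr hr0 hroot p hp
  rw [signVariations_sum_fin_six_eq d hd (fun l => S p 1 1 * S l 0 0 - 2 * S p 0 1 * S l 0 1 + S p 0 0 * S l 1 1) hg] at h
  exact h

/-- **Instance: Gram row of sign pattern `(+,−,+,+,+,+)` ⇒ at most TWO type flips** (sorted support; the pattern of the bottom letter's
row in the sign class `DIIIID` of the census line's hard chamber 1706, read with its global sign — the mirror pattern and the global sign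
flip are covered by applying the theorem to the reflected pencil / to the row's negative, which has the same roots).  [folklore] -/
theorem card_traceFlips_le_two_of_gramRow_signs (d : Fin 6 → ℕ) (hd : StrictMono d) (S : Fin 6 → Matrix (Fin 2) (Fin 2) ℝ)
    (hS : ∀ l, (S l).IsSymm) (r : Fin 20 → ℝ) (hr : StrictMono r) (hr0 : ∀ k, 0 < r k)
    (hroot : ∀ k, r k ∈ (Matrix.det (∑ l, ((X : ℝ[X]) ^ d l) • (S l).map C)).roots)
    (p : Fin 6) (hp : 0 < (S p).det)
    (h0 : 0 < S p 1 1 * S 0 0 0 - 2 * S p 0 1 * S 0 0 1 + S p 0 0 * S 0 1 1)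
    (h1 : S p 1 1 * S 1 0 0 - 2 * S p 0 1 * S 1 0 1 + S p 0 0 * S 1 1 1 < 0)
    (h2 : 0 < S p 1 1 * S 2 0 0 - 2 * S p 0 1 * S 2 0 1 + S p 0 0 * S 2 1 1)
    (h3 : 0 < S p 1 1 * S 3 0 0 - 2 * S p 0 1 * S 3 0 1 + S p 0 0 * S 3 1 1)
    (h4 : 0 < S p 1 1 * S 4 0 0 - 2 * S p 0 1 * S 4 0 1 + S p 0 0 * S 4 1 1)
    (h5 : 0 < S p 1 1 * S 5 0 0 - 2 * S p 0 1 * S 5 0 1 + S p 0 0 * S 5 1 1) :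
    (Finset.univ.filter (fun k : Fin 19 =>
        ((∑ l, r k.castSucc ^ d l • S l) 0 0 + (∑ l, r k.castSucc ^ d l • S l) 1 1) *
          ((∑ l, r k.succ ^ d l • S l) 0 0 + (∑ l, r k.succ ^ d l • S l) 1 1) < 0)).card ≤ 2 := by
  classical
  have hg : ∀ l, S p 1 1 * S l 0 0 - 2 * S p 0 1 * S l 0 1 + S p 0 0 * S l 1 1 ≠ 0 := by
    intro l
    fin_cases l
    · exact h0.ne'
    · exact h1.ne
    · exact h2.ne'
    · exact h3.ne'
    · exact h4.ne'
    · exact h5.ne'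
  refine (card_traceFlips_le_alternations_gramRow d hd S hS r hr hr0 hroot p hp hg).trans ?_
  -- the alternation set is `{0, 1}`
  have hsub : (Finset.univ.filter (fun t : Fin 5 =>
        (S p 1 1 * S t.castSucc 0 0 - 2 * S p 0 1 * S t.castSucc 0 1 + S p 0 0 * S t.castSucc 1 1) *
          (S p 1 1 * S t.succ 0 0 - 2 * S p 0 1 * S t.succ 0 1 + S p 0 0 * S t.succ 1 1) < 0)) ⊆ {0, 1} := by
    intro t ht
    rw [Finset.mem_filter] at ht
    have hlt := ht.2
    fin_cases t
    · simp
    · simp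
    · exfalso
      have : 0 < (S p 1 1 * S 2 0 0 - 2 * S p 0 1 * S 2 0 1 + S p 0 0 * S 2 1 1) *
          (S p 1 1 * S 3 0 0 - 2 * S p 0 1 * S 3 0 1 + S p 0 0 * S 3 1 1) := mul_pos h2 h3
      exact absurd hlt (not_lt.mpr this.le)
    · exfalso
      have : 0 < (S p 1 1 * S 3 0 0 - 2 * S p 0 1 * S 3 0 1 + S p 0 0 * S 3 1 1) *
          (S p 1 1 * S 4 0 0 - 2 * S p 0 1 * S 4 0 1 + S p 0 0 * S 4 1 1) := mul_pos h3 h4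
      exact absurd hlt (not_lt.mpr this.le)
    · exfalso
      have : 0 < (S p 1 1 * S 4 0 0 - 2 * S p 0 1 * S 4 0 1 + S p 0 0 * S 4 1 1) *
          (S p 1 1 * S 5 0 0 - 2 * S p 0 1 * S 5 0 1 + S p 0 0 * S 5 1 1) := mul_pos h4 h5
      exact absurd hlt (not_lt.mpr this.le)
  exact (Finset.card_le_card hsub).trans (by simp)

end Summit.ValiantsHypothesis.ValiantsHypothesis.Theorems.LacunarySymmetroidMatrixDescartes.Census
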